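import Summits.QuantumFields.YangMills.Theorems.UnitScaleTiltProp8IterCorrector
import Summits.QuantumFields.YangMills.Theorems.UnitScaleTiltProp8IterInjective
import Summits.QuantumFields.YangMills.Theorems.UnitScaleTiltProp8AvgLipschitz
import HarnessLib

/-!
# Route `UnitScaleTilt`, crux K1 «MinimiserStabilityRegPr» (stmt-QuantumFields-19200), stub `stub_prop8` (V2) — sub-lemma C_k qualitative, CAPSTONE:
# **THE k-FOLD (0.4)-DESCENT FIBRE IS LOCALLY THE GRAPH OF A UNIQUE MAP (bonds outside β^k) × (targets) → (bonds on β^k)**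
# (`existsUnique_iter_eq_of_near`)

Cell `ym3-torus` ∕ fleet seat `ym-ust-19200-p2` g4.  The qualitative chart «C_k» of the V2∕V3 censuses at a fixed lattice, in one statement: near a field `U₀`
whose iterated (0.4)-averages are small, for every prescription `U₁` of the bond variables (read outside the bottom set `T₀` of a tower with
`T_i = β(T_{i+1})`, `T_k` = everything — the iterated central bonds) and every level-`k` target `W` near `Ū₀^{(k)}`, there is EXACTLY ONE field `U` near `U₀`
with `U = U₁` off `T₀` and `Ū^{(k)} = W`.  Existence: the k-fold selective corrector (p518511) applied to `U₁` (whose iterated averages stay small and close to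
those of `U₀` by the sup-norm Lipschitz bound p525478); uniqueness: the graph property (p524806) with the closeness of the iterated averages again from p525478.
The moduli are explicit and lattice-dependent (`(2|I|)^k`, `(30ℓ)^k`); the k-UNIFORM chart ([Balaban1985Variational] (47)–(48)) remains open.  Sorry-free, no
definition. [folklore] ∕ cited.  References: T. Bałaban, CMP 102 (1985) 277–309 [Balaban1985Variational] ((47)–(48) p.287); CMP 109 (1987) 249–301
[Balaban1987RG1] ((0.4), (0.11) p.253).
-/

noncomputable section

open scoped BigOperators Matrix.Norms.L2Operator Matrix
open Filter Function

namespace Summit.QuantumFields.YangMills.Theorems.Prop8Criticality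

open Literature.MathematicalPhysics.QuantumFieldTheory.Balaban1983to89
open T4Continuum AveragingRT BlockAveraging BlockAveragingHaarAC BlockAveragingEMLHaarAC ExpMeanLog
open Summit.QuantumFields.YangMills.Theorems.BlockAvgCorrector (stokesConst stokesConst_nonneg emlWeight_pos emlWeight_le_one plaqSmall_of_forall_norm_sub_le)

variable {P : Params}

/-- **THE k-FOLD (0.4)-FIBRE AS A GRAPH, EXISTENCE AND UNIQUENESS.**  Notation: `ℓ = (d+2)L`, `A = (30ℓ)^k`, `B = (2∕|I|⁻¹)^k`, `R = B(η + Aρ₁) + ρ₁`.  Let the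
iterated averages `Ū₀^{(i)}`, `i < k`, be `t₀`-small, `‖U₁ − U₀‖ ≤ ρ₁` bondwise, `‖W − Ū₀^{(k)}‖ ≤ η` bondwise, and let `T` be a tower with `T_i = β(T_{i+1})`
(`i < k`) and `T_k` everything.  Under the displayed smallness conditions there is a field `U` with `Ū^{(k)} = W`, `U = U₁` off `T₀`, `‖U − U₀‖ ≤ R` bondwise,
and every field with these three properties equals `U`. [cite: Balaban1985Variational, (47)-(48) p.287; Balaban1987RG1, (0.11) p.253] -/
theorem existsUnique_iter_eq_of_near (k : ℕ) (hk : k ≤ P.m + P.K) {t₀ ρ₁ η : ℝ} (ht₀ : 0 ≤ t₀) (hρ₁ : 0 ≤ ρ₁) (hη : 0 ≤ η)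
    (h1 : stokesConst P * (t₀ + 4 * ((30 * (((P.d + 2) * P.L : ℕ) : ℝ)) ^ k * ρ₁)) ≤ 1 / 24)
    (h2 : stokesConst P * (t₀ + 4 * ((30 * (((P.d + 2) * P.L : ℕ) : ℝ)) ^ k * ρ₁)) +
      (2 / emlWeight P) ^ k * (η + (30 * (((P.d + 2) * P.L : ℕ) : ℝ)) ^ k * ρ₁) ≤ emlWeight P / 16)
    (h3 : stokesConst P * (t₀ + 4 * ((30 * (((P.d + 2) * P.L : ℕ) : ℝ)) ^ k *
        ((2 / emlWeight P) ^ k * (η + (30 * (((P.d + 2) * P.L : ℕ) : ℝ)) ^ k * ρ₁) + ρ₁)) +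
        4 * ((30 * (((P.d + 2) * P.L : ℕ) : ℝ)) ^ k * (2 * ((2 / emlWeight P) ^ k * (η + (30 * (((P.d + 2) * P.L : ℕ) : ℝ)) ^ k * ρ₁) + ρ₁)))) +
      (30 * (((P.d + 2) * P.L : ℕ) : ℝ)) ^ k * (2 * ((2 / emlWeight P) ^ k * (η + (30 * (((P.d + 2) * P.L : ℕ) : ℝ)) ^ k * ρ₁) + ρ₁)) ≤ 1 / 24)
    (h4 : 148 * (stokesConst P * (t₀ + 4 * ((30 * (((P.d + 2) * P.L : ℕ) : ℝ)) ^ k *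
        ((2 / emlWeight P) ^ k * (η + (30 * (((P.d + 2) * P.L : ℕ) : ℝ)) ^ k * ρ₁) + ρ₁)) +
        4 * ((30 * (((P.d + 2) * P.L : ℕ) : ℝ)) ^ k * (2 * ((2 / emlWeight P) ^ k * (η + (30 * (((P.d + 2) * P.L : ℕ) : ℝ)) ^ k * ρ₁) + ρ₁)))) +
      (30 * (((P.d + 2) * P.L : ℕ) : ℝ)) ^ k * (2 * ((2 / emlWeight P) ^ k * (η + (30 * (((P.d + 2) * P.L : ℕ) : ℝ)) ^ k * ρ₁) + ρ₁))) ≤ emlWeight P)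
    (T : (i : ℕ) → Set (PBond P i)) (hT : ∀ i, i < k → T i = centralBond '' T (i + 1)) (hTk : ∀ c : PBond P k, c ∈ T k)
    (U₀ : GaugeField P 0 (Matrix.specialUnitaryGroup (Fin 2) ℂ))
    (hU₀ : ∀ i, i < k → PlaqSmall t₀ (Averaging.iter (fun i => blockAvg (P := P) (j := i) (expMeanLogSU (n := Fin 2))) i U₀))
    (U₁ : GaugeField P 0 (Matrix.specialUnitaryGroup (Fin 2) ℂ))
    (hU₁ : ∀ b, ‖((U₁ b : Matrix.specialUnitaryGroup (Fin 2) ℂ) : Matrix (Fin 2) (Fin 2) ℂ) - (U₀ b : Matrix (Fin 2) (Fin 2) ℂ)‖ ≤ ρ₁)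
    (W : GaugeField P k (Matrix.specialUnitaryGroup (Fin 2) ℂ))
    (hW : ∀ c, ‖((W c : Matrix.specialUnitaryGroup (Fin 2) ℂ) : Matrix (Fin 2) (Fin 2) ℂ) -
      ((Averaging.iter (fun i => blockAvg (P := P) (j := i) (expMeanLogSU (n := Fin 2))) k U₀ c : Matrix.specialUnitaryGroup (Fin 2) ℂ) :
        Matrix (Fin 2) (Fin 2) ℂ)‖ ≤ η) :
    ∃ U : GaugeField P 0 (Matrix.specialUnitaryGroup (Fin 2) ℂ),
      (Averaging.iter (fun i => blockAvg (P := P) (j := i) (expMeanLogSU (n := Fin 2))) k U = W ∧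
        (∀ b : PBond P 0, b ∉ T 0 → U b = U₁ b) ∧
        ∀ b, ‖((U b : Matrix.specialUnitaryGroup (Fin 2) ℂ) : Matrix (Fin 2) (Fin 2) ℂ) - (U₀ b : Matrix (Fin 2) (Fin 2) ℂ)‖ ≤
          (2 / emlWeight P) ^ k * (η + (30 * (((P.d + 2) * P.L : ℕ) : ℝ)) ^ k * ρ₁) + ρ₁) ∧
      ∀ U' : GaugeField P 0 (Matrix.specialUnitaryGroup (Fin 2) ℂ),
        Averaging.iter (fun i => blockAvg (P := P) (j := i) (expMeanLogSU (n := Fin 2))) k U' = W →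
        (∀ b : PBond P 0, b ∉ T 0 → U' b = U₁ b) →
        (∀ b, ‖((U' b : Matrix.specialUnitaryGroup (Fin 2) ℂ) : Matrix (Fin 2) (Fin 2) ℂ) - (U₀ b : Matrix (Fin 2) (Fin 2) ℂ)‖ ≤
          (2 / emlWeight P) ^ k * (η + (30 * (((P.d + 2) * P.L : ℕ) : ℝ)) ^ k * ρ₁) + ρ₁) → U' = U := by
  -- letters
  set A : ℝ := (30 * (((P.d + 2) * P.L : ℕ) : ℝ)) ^ k with hA
  set B : ℝ := (2 / emlWeight P) ^ k with hB
  set R : ℝ := B * (η + A * ρ₁) + ρ₁ with hR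
  have hκ : 0 < emlWeight P := emlWeight_pos P
  have hκ1 : emlWeight P ≤ 1 := emlWeight_le_one P
  have hst : 0 ≤ stokesConst P := stokesConst_nonneg P
  have hℓ1 : (1 : ℝ) ≤ (((P.d + 2) * P.L : ℕ) : ℝ) := by
    exact_mod_cast Nat.one_le_iff_ne_zero.mpr (Nat.mul_ne_zero (by omega) (by have := P.hL.2; omega))
  have hq1 : (1 : ℝ) ≤ 30 * (((P.d + 2) * P.L : ℕ) : ℝ) := by linarith
  have hA1 : 1 ≤ A := one_le_pow₀ hq1
  have hA0 : 0 ≤ A := by linarith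
  have hB0 : 0 ≤ B := by positivity
  have hR0 : 0 ≤ R := by positivity
  have hApow : ∀ i, i ≤ k → (30 * (((P.d + 2) * P.L : ℕ) : ℝ)) ^ i ≤ A := fun i hi => pow_le_pow_right₀ hq1 hi
  -- (1) the iterated averages of `U₁` are close to those of `U₀`, hence small
  have hclose₁ : ∀ i, i ≤ k → ∀ c : PBond P i,
      ‖((Averaging.iter (fun i => blockAvg (P := P) (j := i) (expMeanLogSU (n := Fin 2))) i U₁ c : Matrix.specialUnitaryGroup (Fin 2) ℂ) :
          Matrix (Fin 2) (Fin 2) ℂ) -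
        (Averaging.iter (fun i => blockAvg (P := P) (j := i) (expMeanLogSU (n := Fin 2))) i U₀ c : Matrix (Fin 2) (Fin 2) ℂ)‖ ≤ A * ρ₁ := by
    intro i hi c
    have hsm : ∀ i', i' < i → PlaqSmall t₀ (Averaging.iter (fun i => blockAvg (P := P) (j := i) (expMeanLogSU (n := Fin 2))) i' U₀) :=
      fun i' hi' => hU₀ i' (by omega)
    have h24 : stokesConst P * (t₀ + 4 * ((30 * (((P.d + 2) * P.L : ℕ) : ℝ)) ^ i * ρ₁)) ≤ 1 / 24 :=
      le_trans (by nlinarith [hApow i hi, mul_le_mul_of_nonneg_right (hApow i hi) hρ₁]) h1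
    exact (norm_iter_sub_iter_le_of_close ht₀ hρ₁ U₀ U₁ hU₁ i hsm h24 c).trans (mul_le_mul_of_nonneg_right (hApow i hi) hρ₁)
  have hsm₁ : ∀ i, i < k → PlaqSmall (t₀ + 4 * (A * ρ₁)) (Averaging.iter (fun i => blockAvg (P := P) (j := i) (expMeanLogSU (n := Fin 2))) i U₁) :=
    fun i hi => plaqSmall_of_forall_norm_sub_le (hU₀ i hi) (hclose₁ i hi.le)
  -- (2) existence: the k-fold selective corrector applied to `U₁`
  have hWU₁ : ∀ c, ‖((W c : Matrix.specialUnitaryGroup (Fin 2) ℂ) : Matrix (Fin 2) (Fin 2) ℂ) -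
      ((Averaging.iter (fun i => blockAvg (P := P) (j := i) (expMeanLogSU (n := Fin 2))) k U₁ c : Matrix.specialUnitaryGroup (Fin 2) ℂ) :
        Matrix (Fin 2) (Fin 2) ℂ)‖ ≤ η + A * ρ₁ := by
    intro c
    have h1' := hW c
    have h2' := hclose₁ k le_rfl c
    calc _ ≤ ‖((W c : Matrix.specialUnitaryGroup (Fin 2) ℂ) : Matrix (Fin 2) (Fin 2) ℂ) -
            ((Averaging.iter (fun i => blockAvg (P := P) (j := i) (expMeanLogSU (n := Fin 2))) k U₀ c : Matrix.specialUnitaryGroup (Fin 2) ℂ) :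
              Matrix (Fin 2) (Fin 2) ℂ)‖ +
          ‖((Averaging.iter (fun i => blockAvg (P := P) (j := i) (expMeanLogSU (n := Fin 2))) k U₀ c : Matrix.specialUnitaryGroup (Fin 2) ℂ) :
              Matrix (Fin 2) (Fin 2) ℂ) -
            (Averaging.iter (fun i => blockAvg (P := P) (j := i) (expMeanLogSU (n := Fin 2))) k U₁ c : Matrix (Fin 2) (Fin 2) ℂ)‖ :=
          norm_sub_le_norm_sub_add_norm_sub _ _ _
      _ ≤ η + A * ρ₁ := add_le_add h1' (by rw [norm_sub_rev]; exact h2')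
  have hTclosed : ∀ i, i < k → ∀ c : PBond P (i + 1), c ∈ T (i + 1) → centralBond c ∈ T i := by
    intro i hi c hc
    rw [hT i hi]
    exact ⟨c, hc, rfl⟩
  have hpos : 0 ≤ t₀ + 4 * (A * ρ₁) := by positivity
  have h2' : stokesConst P * (t₀ + 4 * (A * ρ₁)) + (2 / emlWeight P) ^ k * (η + A * ρ₁) ≤ emlWeight P / 16 := by
    have : stokesConst P * (t₀ + 4 * (A * ρ₁)) = stokesConst P * (t₀ + 4 * ((30 * (((P.d + 2) * P.L : ℕ) : ℝ)) ^ k * ρ₁)) := by rw [hA]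
    rw [this]; exact h2
  obtain ⟨U, hUW, hUoff, hUdist⟩ := exists_iter_eq_of_near (P := P) hpos k hk U₁ hsm₁ T hTclosed (η + A * ρ₁) (by positivity) h2' W hWU₁
    (fun c hc => absurd (hTk c) hc)
  have hUR : ∀ b, ‖((U b : Matrix.specialUnitaryGroup (Fin 2) ℂ) : Matrix (Fin 2) (Fin 2) ℂ) - (U₀ b : Matrix (Fin 2) (Fin 2) ℂ)‖ ≤ R := by
    intro b
    calc _ ≤ ‖((U b : Matrix.specialUnitaryGroup (Fin 2) ℂ) : Matrix (Fin 2) (Fin 2) ℂ) - (U₁ b : Matrix (Fin 2) (Fin 2) ℂ)‖ +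
          ‖((U₁ b : Matrix.specialUnitaryGroup (Fin 2) ℂ) : Matrix (Fin 2) (Fin 2) ℂ) - (U₀ b : Matrix (Fin 2) (Fin 2) ℂ)‖ := norm_sub_le_norm_sub_add_norm_sub _ _ _
      _ ≤ B * (η + A * ρ₁) + ρ₁ := add_le_add (hUdist b) (hU₁ b)
  refine ⟨U, ⟨hUW, hUoff, hUR⟩, fun U' hU'W hU'off hU'R => ?_⟩
  -- (3) uniqueness: the graph property, with the closeness of the iterated averages from the Lipschitz bound about `U`
  have hUU₀close : ∀ i, i ≤ k → ∀ c : PBond P i,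
      ‖((Averaging.iter (fun i => blockAvg (P := P) (j := i) (expMeanLogSU (n := Fin 2))) i U c : Matrix.specialUnitaryGroup (Fin 2) ℂ) :
          Matrix (Fin 2) (Fin 2) ℂ) -
        (Averaging.iter (fun i => blockAvg (P := P) (j := i) (expMeanLogSU (n := Fin 2))) i U₀ c : Matrix (Fin 2) (Fin 2) ℂ)‖ ≤ A * R := by
    intro i hi c
    have hsm : ∀ i', i' < i → PlaqSmall t₀ (Averaging.iter (fun i => blockAvg (P := P) (j := i) (expMeanLogSU (n := Fin 2))) i' U₀) :=
      fun i' hi' => hU₀ i' (by omega)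
    have h24 : stokesConst P * (t₀ + 4 * ((30 * (((P.d + 2) * P.L : ℕ) : ℝ)) ^ i * R)) ≤ 1 / 24 := by
      have hi' := hApow i hi
      have : stokesConst P * (t₀ + 4 * ((30 * (((P.d + 2) * P.L : ℕ) : ℝ)) ^ i * R)) ≤ stokesConst P * (t₀ + 4 * (A * R)) := by
        apply mul_le_mul_of_nonneg_left _ hst
        nlinarith [mul_le_mul_of_nonneg_right hi' hR0]
      refine this.trans (le_trans ?_ h3)
      rw [hR, hA, hB]
      nlinarith [hst, hA0, hB0, hR0, hη, hρ₁, mul_nonneg hA0 hR0,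
        mul_nonneg hst (mul_nonneg hA0 hR0), pow_nonneg (by positivity : (0:ℝ) ≤ 30 * (((P.d + 2) * P.L : ℕ) : ℝ)) k,
        pow_nonneg (by positivity : (0:ℝ) ≤ 2 / emlWeight P) k]
    exact (norm_iter_sub_iter_le_of_close ht₀ hR0 U₀ U hUR i hsm h24 c).trans (mul_le_mul_of_nonneg_right (hApow i hi) hR0)
  have hsmU : ∀ i, i < k → PlaqSmall (t₀ + 4 * (A * R)) (Averaging.iter (fun i => blockAvg (P := P) (j := i) (expMeanLogSU (n := Fin 2))) i U) :=
    fun i hi => plaqSmall_of_forall_norm_sub_le (hU₀ i hi) (hUU₀close i hi.le)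
  -- `U′` is within `2R` of `U`, hence its iterated averages are within `A·2R` of those of `U`
  have hU'U : ∀ b, ‖((U' b : Matrix.specialUnitaryGroup (Fin 2) ℂ) : Matrix (Fin 2) (Fin 2) ℂ) - (U b : Matrix (Fin 2) (Fin 2) ℂ)‖ ≤ 2 * R := by
    intro b
    calc _ ≤ ‖((U' b : Matrix.specialUnitaryGroup (Fin 2) ℂ) : Matrix (Fin 2) (Fin 2) ℂ) - (U₀ b : Matrix (Fin 2) (Fin 2) ℂ)‖ +
          ‖((U₀ b : Matrix.specialUnitaryGroup (Fin 2) ℂ) : Matrix (Fin 2) (Fin 2) ℂ) - (U b : Matrix (Fin 2) (Fin 2) ℂ)‖ := norm_sub_le_norm_sub_add_norm_sub _ _ _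
      _ ≤ R + R := add_le_add (hU'R b) (by rw [norm_sub_rev]; exact hUR b)
      _ = 2 * R := by ring
  have h2R0 : 0 ≤ 2 * R := by positivity
  have hclose' : ∀ i, i < k → ∀ c : PBond P (i + 1),
      ‖((Averaging.iter (fun i => blockAvg (P := P) (j := i) (expMeanLogSU (n := Fin 2))) i U' (centralBond c) :
          Matrix.specialUnitaryGroup (Fin 2) ℂ) : Matrix (Fin 2) (Fin 2) ℂ) -
        (Averaging.iter (fun i => blockAvg (P := P) (j := i) (expMeanLogSU (n := Fin 2))) i U (centralBond c) : Matrix (Fin 2) (Fin 2) ℂ)‖ ≤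
        A * (2 * R) := by
    intro i hi c
    have hsm : ∀ i', i' < i → PlaqSmall (t₀ + 4 * (A * R)) (Averaging.iter (fun i => blockAvg (P := P) (j := i) (expMeanLogSU (n := Fin 2))) i' U) :=
      fun i' hi' => hsmU i' (by omega)
    have h24 : stokesConst P * (t₀ + 4 * (A * R) + 4 * ((30 * (((P.d + 2) * P.L : ℕ) : ℝ)) ^ i * (2 * R))) ≤ 1 / 24 := by
      have hi' := hApow i hi.le
      have : stokesConst P * (t₀ + 4 * (A * R) + 4 * ((30 * (((P.d + 2) * P.L : ℕ) : ℝ)) ^ i * (2 * R))) ≤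
          stokesConst P * (t₀ + 4 * (A * R) + 4 * (A * (2 * R))) := by
        apply mul_le_mul_of_nonneg_left _ hst
        nlinarith [mul_le_mul_of_nonneg_right hi' h2R0]
      refine this.trans (le_trans ?_ h3)
      rw [hR, hA, hB]
      nlinarith [hst, hA0, hB0, hR0, hη, hρ₁, mul_nonneg hA0 hR0,
        pow_nonneg (by positivity : (0:ℝ) ≤ 30 * (((P.d + 2) * P.L : ℕ) : ℝ)) k,
        pow_nonneg (by positivity : (0:ℝ) ≤ 2 / emlWeight P) k]
    exact (norm_iter_sub_iter_le_of_close (by positivity) h2R0 U U' hU'U i hsm h24 (centralBond c)).trans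
      (mul_le_mul_of_nonneg_right (hApow i hi.le) h2R0)
  have hTsub : ∀ i, i < k → T i ⊆ centralBond '' T (i + 1) := fun i hi => (hT i hi).le
  have hagree : ∀ b : PBond P 0, b ∉ T 0 → U' b = U b := fun b hb => by rw [hU'off b hb, hUoff b hb]
  have h24f : stokesConst P * (t₀ + 4 * (A * R) + 4 * (A * (2 * R))) + A * (2 * R) ≤ 1 / 24 := by
    rw [hR, hA, hB]; exact h3
  have hκf : 148 * (stokesConst P * (t₀ + 4 * (A * R) + 4 * (A * (2 * R))) + A * (2 * R)) ≤ emlWeight P := by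
    rw [hR, hA, hB]; exact h4
  exact eq_of_iter_eq_of_agree (by positivity) (by positivity) h24f hκf k hk T hTsub U U' hsmU hclose' hagree (by rw [hU'W, hUW])

end Summit.QuantumFields.YangMills.Theorems.Prop8Criticality

end
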